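import Summits.AnomalousDissipation.AnomalousDissipation.Theses.QuarticLadder
import Summits.AnomalousDissipation.AnomalousDissipation.Theorems.UniformResolution.Negative.Shape
import Summits.AnomalousDissipation.AnomalousDissipation.Theorems.MomentParityUniformResolutionOfResolvedDissipation
import Summits.AnomalousDissipation.AnomalousDissipation.Theorems.MomentParityResolvedDissipationOfLerayHopfEnergyEquality

/-!
# Strategist census sketch, seat b1, crux `UniformResolution` (stmt-AnomalousDissipation-14330)

Typed companion of `STRATEGY-CENSUS.md` (seat planner-cstrat-stmt-AnomalousDissipation-14330-b1-0,
2026-08-17). Nothing here is a route item or a registered stub. Every theorem is a CHEAP, kernel-checked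
location of a census signature relative to the crux `Theses.QuarticLadder.UniformResolution`
(≡ `Theses.MomentParity.UniformResolution`, defeq twin bodies — `quarticLadder_iff_momentParity`).

* §0  the two route decls are one proposition.
* §Transfer / §Decomposition (split by force class): `LHEEAt ν f` (Leray–Hopf energy equality at one
  viscosity and one force) and `ur_body_of_lhee_along` — the crux's implication HOLDS, with unchanged
  budgets, for every force `f` such that NS(ν_j, f) has the Leray–Hopf energy equality at every `j`
  (composition of the landed bracket `LhBracket.resolvedAt_of_lerayHopfEnergyEquality` with the landed
  closure `stub_closure`); `uniformResolution_of_lhee` — the global form; `lheeAt_of_lionsClassAt` — the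
  hypothesis holds on the Lions–Shinbrot class (landed `lerayHopfEnergyEquality_of_lionsClass`).
* §Negation (vacuity side): `uniformResolution_of_not_dwise` — the crux holds outright if NO force admits a
  `d`-wise Galerkin-ensemble zeroth law (contrapositive of the landed `dwise_of_not_uniformResolution`).
* §Decomposition (freedom F1 killed): `resolvable_left_of_isResolved_mixture` — admixing a resolved law
  (a steady Dirac, a laminar state) to a loud law never CREATES resolution: if `a • μ₁ + b • μ₂` is
  `κ`-resolved with `a ≠ 0` finite and `μ₂` of finite mean enstrophy, then `μ₁` alone is resolved by a
  reparametrised schedule (`exists_isResolved_left_of_mixture`).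
-/

noncomputable section

set_option linter.dupNamespace false

namespace Summit.AnomalousDissipation.AnomalousDissipation.Cruxes.UniformResolution.StrategistB1

open MeasureTheory Filter Topology Set
open scoped ENNReal InnerProductSpace RealInnerProductSpace
open Literature.Analysis.FunctionSpaces Literature.Analysis.FluidPDE
open Summit.AnomalousDissipation.AnomalousDissipation.Theorems.QuarticGate.Negative
  (IsLevel IsBandTest polyGrad IsPolyStationary)
open Summit.AnomalousDissipation.AnomalousDissipation.Theorems
open Summit.AnomalousDissipation.AnomalousDissipation.Theorems.UniformResolution.Negative
  (IsResolved IsLoudFamilyAt IsResolvedLoudFamilyAt DwiseGalerkinInvariantLoud)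

/-- The 3-torus. -/
abbrev T3 : Type := UnitAddTorus (Fin 3)
/-- Velocity values. -/
abbrev R3 : Type := EuclideanSpace ℝ (Fin 3)
/-- The energy space `H = L²_σ(T³)` of the crux. -/
abbrev H3 : Type := ↥(Torus.energySpace (Fin 3))

/-- Local notation for the real Hilbert space `L²(T³; ℝ³)`. -/
local notation "L2T3" => Lp (EuclideanSpace ℝ (Fin 3)) 2 (volume : Measure (UnitAddTorus (Fin 3)))

/-! ## §0 The crux decl of route QuarticLadder is the MomentParity decl (one proposition) -/

/-- The two route files declare `UniformResolution` with verbatim-identical bodies. -/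
theorem quarticLadder_iff_momentParity :
    Theses.QuarticLadder.UniformResolution ↔ Theses.MomentParity.UniformResolution :=
  Iff.rfl

/-! ## §Transfer / §Decomposition — the Leray–Hopf energy-equality bracket in UR currency -/

/-- **LHEE at `(ν, f)`**: every global Leray–Hopf weak solution of NS(ν, f) on `T³` (tree sense
`Torus.IsGlobalLerayHopf`) satisfies the energy EQUALITY between positive times. Verbatim the hypothesis
of the landed `LhBracket.resolvedAt_of_lerayHopfEnergyEquality`; OPEN for `d = 3` (Leray 1934 §34, Lions
1960, Shinbrot 1974; 2025 status: Maremonti arXiv:2512.04654 — a dichotomy, not a proof). -/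
def LHEEAt (ν : ℝ) (f : T3 → R3) : Prop :=
  ∀ (u₀ : T3 → R3) (u : ℝ → T3 → R3), Torus.IsGlobalLerayHopf ν (fun _ => f) u₀ u →
    ∀ (t₀ t₁ : ℝ), 0 < t₀ → t₀ ≤ t₁ →
      Torus.kineticEnergy (u t₁) + ν * (∫⁻ τ in Ioo t₀ t₁, Torus.eGradNormSq (u τ)).toReal =
        Torus.kineticEnergy (u t₀) + ∫ τ in t₀..t₁, ∫ x, ⟪f x, u τ x⟫_ℝ

/-- **UR holds, force by force, wherever LHEE holds along the viscosity sequence** (unchanged budgets).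
For a smooth mean-zero force `f` and positive `ν_j`: if NS(ν_j, f) has the Leray–Hopf energy equality at
every `j`, then loud `d`-wise level families at every `j` are RESOLVED loud families at every `j` with the
same `(E, ε)`. Proof: at each `j` the bracket gives ONE schedule `κ_j` resolving every all-order-stationary
level law in the antecedent's ball (`resolvedAt_of_lerayHopfEnergyEquality`), and the landed closure
`stub_closure` turns the `d`-wise loud laws into one all-order-stationary loud law per level. So the crux,
restricted to the class of forces `{f | ∀ j, LHEEAt (ν j) f}`, is a THEOREM; what remains is exactly the
class of forces with an energy-dropping Leray–Hopf solution at some `ν_j` (census §Decomposition D-b1). -/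
theorem ur_body_of_lhee_along (f : T3 → R3) (hfs : Torus.IsSmooth f) (hfz : Torus.HasZeroMean f)
    (ν : ℕ → ℝ) (E ε : ℝ) (hν : ∀ j, 0 < ν j) (hLHEE : ∀ j, LHEEAt (ν j) f)
    (hloud : ∀ j, IsLoudFamilyAt f (ν j) E ε) :
    ∀ j, IsResolvedLoudFamilyAt f (ν j) E ε := by
  intro j
  obtain ⟨R, hfreq⟩ := hloud j
  obtain ⟨κ, hκ⟩ :=
    MomentParityResolvedDissipation.LhBracket.resolvedAt_of_lerayHopfEnergyEquality (hν j) hfs hfz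
      (hLHEE j) R
  refine ⟨R, κ, hfreq.mono fun N hN d => ?_⟩
  obtain ⟨μ, hp, hl, hb, hst, hE, hD⟩ := MomentParityUniformResolution.stub_closure f hfs (ν j) N E ε R hN
  refine ⟨μ, hp, hl, hb, ?_, hst d, hE, hD⟩
  intro n
  exact hκ N μ hp hl hb (fun m g P hg => hst (P.totalDegree + 1) m g P hg le_rfl) n

/-- **Global form: LHEE ⟹ `QuarticLadder.UniformResolution`** (tree theorems composed:
`resolvedDissipation_of_lerayHopfEnergyEquality`, `uniformResolution_of_resolvedDissipation`, §0). -/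
theorem uniformResolution_of_lhee
    (hLHEE : ∀ ν : ℝ, 0 < ν → ∀ f : T3 → R3, Torus.IsSmooth f → Torus.IsDivFree f → Torus.HasZeroMean f →
      LHEEAt ν f) :
    Theses.QuarticLadder.UniformResolution :=
  MomentParityUniformResolution.uniformResolution_of_resolvedDissipation
    (MomentParityResolvedDissipation.LhBracket.resolvedDissipation_of_lerayHopfEnergyEquality hLHEE)

/-- **The LHEE hypothesis HOLDS on the Lions–Shinbrot class** at `(ν, f)`: if every global Leray–Hopf
solution of NS(ν, f) has `L²` datum and is `L⁴L⁴` on every `(0, T)`, then `LHEEAt ν f` (landed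
`lerayHopfEnergyEquality_of_lionsClass`). NB (census §Transfer T-b1-4): Lindberg arXiv:2412.13066 shows that
for a Baire-generic `L²` datum NO weak solution of the unforced problem lies in `L⁴(0,∞;L⁴)` or in the other
known sufficient classes — the integrability-class road to LHEE is not universal. -/
theorem lheeAt_of_lionsClassAt {ν : ℝ} (hν : 0 < ν) {f : T3 → R3} (hf : Torus.IsSmooth f)
    (hLions : ∀ (u₀ : T3 → R3) (u : ℝ → T3 → R3), Torus.IsGlobalLerayHopf ν (fun _ => f) u₀ u →
      MemLp u₀ 2 volume ∧ ∀ T : ℝ, 0 < T → ∫⁻ s in Ioo 0 T, ∫⁻ x, ‖u s x‖ₑ ^ 4 < ⊤) :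
    LHEEAt ν f := by
  intro u₀ u hLH t₀ t₁ ht₀ ht₀₁
  obtain ⟨hu₀, hL4⟩ := hLions u₀ u hLH
  exact MomentParityResolvedDissipation.LhBracket.lerayHopfEnergyEquality_of_lionsClass ν hν f hf u₀ u hLH
    hu₀ hL4 t₀ t₁ ht₀ ht₀₁

/-- **The force-class split, assembled** (census §Decomposition D-b1-1): UR is the conjunction of its
restriction to the LHEE-good forces (a theorem: `ur_body_of_lhee_along`) and its restriction to the
remaining forces. Recorded as the typed reason the split is NOT filed: the second conjunct is the crux
verbatim on a class nobody can shrink (its emptiness is the Leray–Hopf energy-equality problem). -/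
theorem uniformResolution_of_badClass
    (hbad : ∀ f : T3 → R3, Torus.IsSmooth f → Torus.IsDivFree f → Torus.HasZeroMean f →
      ∀ (ν : ℕ → ℝ) (E ε : ℝ), (∀ j, 0 < ν j) → Tendsto ν atTop (𝓝 0) → 0 < ε →
      (∃ j, ¬ LHEEAt (ν j) f) → (∀ j, IsLoudFamilyAt f (ν j) E ε) →
      ∃ E' ε' : ℝ, 0 < ε' ∧ ∀ j, IsResolvedLoudFamilyAt f (ν j) E' ε') :
    Theses.QuarticLadder.UniformResolution := by
  show Theses.MomentParity.UniformResolution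
  rw [UniformResolution.Negative.uniformResolution_iff]
  intro f hfs hfd hfz ν E ε hν hν0 hε hloud
  by_cases hgood : ∀ j, LHEEAt (ν j) f
  · exact ⟨E, ε, hε, ur_body_of_lhee_along f hfs hfz ν E ε hν hgood hloud⟩
  · push Not at hgood
    exact hbad f hfs hfd hfz ν E ε hν hν0 hε hgood hloud

/-! ## §Negation — the vacuity side -/

/-- **No `d`-wise Galerkin-ensemble zeroth law for ANY force ⟹ the crux holds (vacuously).** Contrapositive
of the landed `dwise_of_not_uniformResolution`. The hypothesis is a NEGATIVE resolution of the
Galerkin-ensemble form of the summit (route Neg's territory) — summit-type; recorded as the typed lower end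
of the bracket `¬DwiseZerothLaw ∨ LHEE-along ⟹ UR`. -/
theorem uniformResolution_of_not_dwise (h : ¬ DwiseGalerkinInvariantLoud) :
    Theses.QuarticLadder.UniformResolution := by
  show Theses.MomentParity.UniformResolution
  by_contra hUR
  exact h (UniformResolution.Negative.dwise_of_not_uniformResolution hUR)

/-! ## §Decomposition — freedom F1 (admixtures) is void: mixing never creates resolution -/

/-- Band enstrophy is at most total enstrophy (spectral, termwise). -/
private theorem lintegral_band_le (K : ℕ) (μ : Measure H3) :
    ∫⁻ u, Torus.eGradNormSq (Torus.fourierTruncate K (u.1 : T3 → R3)) ∂μ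
      ≤ ∫⁻ u, Torus.eGradNormSq (u.1 : T3 → R3) ∂μ := by
  refine lintegral_mono fun u => ?_
  exact Literature.Analysis.FluidPDE.Torus.eGradNormSq_fourierTruncate_le
    ((Lp.memLp (u.1 : L2T3)).integrable one_le_two) K

/-- **Mixing lemma.** If the mixture `a • μ₁ + b • μ₂` (`a ≠ 0` finite, `b · ∫‖∇u‖²dμ₂ < ∞`) is
`κ`-resolved, then for every tolerance `1/(n+1)` some cutoff `κ m` of the SAME schedule resolves `μ₁`
alone. (So a loud law that is not resolvable stays unresolvable after admixing any amount of steady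
Diracs / laminar states; the freedom "(i) Dirac/steady admixtures inside the budget" of the c15 PICKED.md
cannot bite.) -/
theorem resolvable_left_of_isResolved_mixture {κ : ℕ → ℕ} {μ₁ μ₂ : Measure H3} {a b : ℝ≥0∞}
    (ha : a ≠ 0) (ha' : a ≠ ⊤) (hfin : b * ∫⁻ u, Torus.eGradNormSq (u.1 : T3 → R3) ∂μ₂ ≠ ⊤)
    (hres : IsResolved κ (a • μ₁ + b • μ₂)) (n : ℕ) :
    ∃ m : ℕ, ∫⁻ u, Torus.eGradNormSq (u.1 : T3 → R3) ∂μ₁ ≤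
      (∫⁻ u, Torus.eGradNormSq (Torus.fourierTruncate (κ m) (u.1 : T3 → R3)) ∂μ₁) +
        ((n : ℝ≥0∞) + 1)⁻¹ := by
  -- target tolerance after division by `a`
  set c : ℝ≥0∞ := a * ((n : ℝ≥0∞) + 1)⁻¹ with hc
  have hn1 : ((n : ℝ≥0∞) + 1)⁻¹ ≠ 0 := ENNReal.inv_ne_zero.2 (by simp)
  have hc0 : c ≠ 0 := mul_ne_zero ha hn1
  obtain ⟨m, hm⟩ := ENNReal.exists_inv_nat_lt hc0
  refine ⟨m, ?_⟩
  -- names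
  set Z₁ : ℝ≥0∞ := ∫⁻ u, Torus.eGradNormSq (u.1 : T3 → R3) ∂μ₁ with hZ₁
  set Z₂ : ℝ≥0∞ := ∫⁻ u, Torus.eGradNormSq (u.1 : T3 → R3) ∂μ₂ with hZ₂
  set B₁ : ℝ≥0∞ := ∫⁻ u, Torus.eGradNormSq (Torus.fourierTruncate (κ m) (u.1 : T3 → R3)) ∂μ₁ with hB₁
  set B₂ : ℝ≥0∞ := ∫⁻ u, Torus.eGradNormSq (Torus.fourierTruncate (κ m) (u.1 : T3 → R3)) ∂μ₂ with hB₂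
  set e : ℝ≥0∞ := ((m : ℝ≥0∞) + 1)⁻¹ with he
  -- the resolution inequality of the mixture at index `m`, split over the two components
  have hmix : a * Z₁ + b * Z₂ ≤ a * B₁ + b * B₂ + e := by
    have h := hres m
    simp only [lintegral_add_measure, lintegral_smul_measure] at h
    simpa [hZ₁, hZ₂, hB₁, hB₂, smul_eq_mul] using h
  -- the second component's band part is at most its total, and finite
  have hB₂le : b * B₂ ≤ b * Z₂ := mul_le_mul_right (lintegral_band_le (κ m) μ₂) b
  have hB₂fin : b * B₂ ≠ ⊤ := ne_top_of_le_ne_top hfin hB₂le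
  -- cancel `b * B₂`
  have hstep : a * Z₁ + b * B₂ ≤ (a * B₁ + e) + b * B₂ := by
    calc a * Z₁ + b * B₂ ≤ a * Z₁ + b * Z₂ := add_le_add le_rfl hB₂le
      _ ≤ a * B₁ + b * B₂ + e := hmix
      _ = (a * B₁ + e) + b * B₂ := by ring
  have haZ : a * Z₁ ≤ a * B₁ + e := ENNReal.le_of_add_le_add_right hB₂fin hstep
  -- divide by `a`
  have hdiv : Z₁ ≤ B₁ + a⁻¹ * e := by
    have h1 : a⁻¹ * (a * Z₁) ≤ a⁻¹ * (a * B₁ + e) := mul_le_mul_right haZ _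
    have hinv : a⁻¹ * a = 1 := ENNReal.inv_mul_cancel ha ha'
    calc Z₁ = a⁻¹ * (a * Z₁) := by rw [← mul_assoc, hinv, one_mul]
      _ ≤ a⁻¹ * (a * B₁ + e) := h1
      _ = B₁ + a⁻¹ * e := by rw [mul_add, ← mul_assoc, hinv, one_mul]
  -- the chosen `m` makes `a⁻¹ * e ≤ (n+1)⁻¹`
  have hem : e ≤ c := by
    have h1 : e ≤ (m : ℝ≥0∞)⁻¹ := ENNReal.inv_le_inv.2 (by simp)
    exact h1.trans hm.le
  have htol : a⁻¹ * e ≤ ((n : ℝ≥0∞) + 1)⁻¹ := by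
    calc a⁻¹ * e ≤ a⁻¹ * c := mul_le_mul_right hem _
      _ = ((n : ℝ≥0∞) + 1)⁻¹ := by rw [hc, ← mul_assoc, ENNReal.inv_mul_cancel ha ha', one_mul]
  exact hdiv.trans (add_le_add le_rfl htol)

/-- **Corollary (freedom F1 void).** Under the hypotheses of the mixing lemma `μ₁` is resolved by a
reparametrisation of the same schedule. -/
theorem exists_isResolved_left_of_mixture {κ : ℕ → ℕ} {μ₁ μ₂ : Measure H3} {a b : ℝ≥0∞}
    (ha : a ≠ 0) (ha' : a ≠ ⊤) (hfin : b * ∫⁻ u, Torus.eGradNormSq (u.1 : T3 → R3) ∂μ₂ ≠ ⊤)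
    (hres : IsResolved κ (a • μ₁ + b • μ₂)) : ∃ κ' : ℕ → ℕ, IsResolved κ' μ₁ := by
  choose m hm using resolvable_left_of_isResolved_mixture ha ha' hfin hres
  exact ⟨fun n => κ (m n), fun n => hm n⟩

end Summit.AnomalousDissipation.AnomalousDissipation.Cruxes.UniformResolution.StrategistB1

end
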